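/-
Copyright: the b2b-balaban T⁴-continuum CRUX team, row NE7b leaf lineage `t4-ne7b-formalise-leaf-01` (gen 84). Project licence.
-/
import Literature.MathematicalPhysics.QuantumFieldTheory.Balaban1983to89.B9SectEKernel
import Literature.MathematicalPhysics.QuantumFieldTheory.Balaban1983to89.B4Sect5Torus
import Literature.MathematicalPhysics.QuantumFieldTheory.Balaban1983to89.B2Lemma25Proof

/-!
# THE LOCATED-INDEX DECAY LETTERS BY VALUE: for indices placed on `ℤ^d` by `loc` with fibres `≤ m₀` — the pseudo-metric letters of
# `d(i,j) = |loc i − loc j|₁`, the summable-weight constant `Σ_j e^{−δ₀d(i,j)} ≤ K₀ := m₀(1 + 2∕δ₀)^d`, the Combes–Thomas Schur letter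
# `Σ_j |T i j|(e^{κd(i,j)} − 1) ≤ κ·c₀(4∕δ₁)m₀(1 + 4∕δ₁)^d` from the entrywise decay `|T i j| ≤ c₀e^{−δ₁d(i,j)}` — and the END BY NAME:
# a `γ`-coercive, entrywise-decaying `T` has `|(T + x·1)⁻¹(i,j)| ≤ 2γ⁻¹e^{−κ⋆d(i,j)}` for ALL `x ≥ 0`, `κ⋆ = min(δ₁∕4, γ∕2R)` explicit
# (row NE7b, node U5c; `B9SectEKernel.resolvent_decay_uniform` with its Schur input (b) DISCHARGED; [folklore] lattice sums + finite Combes–Thomas)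

Cell `pub-balaban`, sub-cell `t4`, spine estimate NE7b (`T4WeightBudget.RelWeightBound`; the cell's OWN estimate — NOT PRINTED in
[Bałaban 1983–89], NOT PROVED).  Crux-route work under `Spine/NE7b/` by a row leaf (`t4-ne7b-formalise-leaf-01` gen 84) on the windowed
convexity road (R-P1) under FREEZE (0)'s crux-prover clause; NOTHING of Bałaban's is named as a Lean object, valued or asserted; no
`T4Continuum/Support` leaf typed; no `def`; zero `sorry`.  Imports (all with hub oleans), used BY NAME only: the reader cell's
`….Balaban1983to89.B9SectEKernel` (r1; `resolvent_decay_uniform`; transitively `QGQInverse.Coercive ∕ inverse_decay`),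
`….B4Sect5Torus` (pv09: the GENERALISED [B4] Sect. 5 theorem `sect5_uniform` over any finite index set with a pseudo-distance and a
lattice-sum profile, its letters `IsPseudoDist ∕ SumBound ∕ Hyp56`, constants `cSt ∕ dSt`; transitively `B4Sect5Proof.exp_weight_le`:
`e^{−δ₀n}(e^{κn} − 1) ≤ κ(4∕δ₀)e^{−δ₀n∕2}` for `0 ≤ κ ≤ δ₀∕4`), `….B2Lemma25Proof` (ONLY `l1dist` and the box-product bound `sum_exp_neg_l1dist_le`;
nothing of [B2]'s content).

WHY.  Two NOT-HEREs of this road and one census line of the reader cell name the same missing numbers.  (1) `…CovarianceKernelFloor` (CKF,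
leaf-03 g144: the (N4) floor `QGQInverse.Coercive A (B₀K₀)⁻¹` from a decaying covariance kernel) DISPLAYS `hsum : Σ_j exp(−δ₀·d i j) ≤ K₀` and
lists «the lattice value of `K₀(δ₀, d)`» as NOT HERE.  (2) The written repair of print's `γ₀ ∕ γ₁` interface ([B9] CMP **99** Sect. E p. 428,
GAPS G-B9-09; `HOME/b2b-balaban-r1/SectE-interface-proof.md`) proves its Theorem E3 — the resolvent family `(C*Δ_kC + x)⁻¹` behind [B10] (63)
and [B13] (2.7) decays UNIFORMLY in `x ≥ 0` — by `B9SectEKernel.resolvent_decay_uniform`, whose Schur hypotheses `hrow ∕ hcol`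
(`Σ_j |T i j|(e^{κd} − 1) ≤ ρ < γ`) are input (b) «from `|T(b,b′)| ≤ c₀′e^{−δ₁|b−b′|}` … by taking `κ` small»; its census §8.5 lists «the
Schur inputs … of E3(b)» as NOT kernel-checked.  (3) `…SectECovarianceLetters` (leaf-06) names E3 «ALREADY the kernel's
`resolvent_decay_uniform`» — by name, with (b) displayed.  THIS FILE values both letters for ANY index set LOCATED on `ℤ^d` with bounded
fibres (unit-lattice bonds × colours: `m₀ = d·dim 𝔤` at each lower endpoint; blocks; cubes — the consumer chooses `loc`), and composes the
END by name: two letters of `T` ITSELF (a floor `γ` and an entrywise decay `(c₀, δ₁)`) give the decay of every `(T + x)⁻¹` with an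
explicit rate `κ⋆ > 0` and amplitude `2γ⁻¹`, constants independent of `x` and of whatever the letters are uniform in.  The tree already
values this Schur letter ABSTRACTLY: `B4Sect5Torus.weightedRowSum_le` (pv09) gives `Σ_q |A p q|(e^{κρ} − 1) ≤ κ·weightC K c₀ δ₀` for ANY
pseudo-distance `ρ` with a lattice-sum PROFILE `K` (`SumBound ρ K`), and `B4Sect5Torus.sect5_uniform` the whole [B4] Sect. 5 theorem ((5.7) ∕
(5.8) ∕ (5.10), the `x = 0` member with compressions and perturbations) in that generality; `B4Sect5Proof` §2 (on `B4.Idx Ω N`),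
`B6Ineq243BoxProof` (a box) and `B13Eq216LatticeSum.WRS.of_entrywise_loc` (the PLAIN weight `e^{κ′d}` on `Fin ν`) are instances ∕ cousins.
What was missing is the LOCATED-INDEX instance — the profile `K(a) = m₀(1 + 2∕a)^d` for any `loc` with bounded fibres (§2, §6
`sumBound_locDist`) — and the RESOLVENT-FAMILY member `x ≥ 0` in that currency (§4); §6 then hands located indices to `sect5_uniform` BY NAME.

WHAT IS PROVED ([folklore]; `loc : m → (Fin d → ℤ)`, `hfib : ∀ z, #{j | loc j = z} ≤ m₀`, `d(i,j) := l1dist (loc i) (loc j)` written inline):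
* §1 THE PSEUDO-METRIC LETTERS: `l1dist_self`, `l1dist_triangle`, **`locDist_letters`** (symmetric, zero diagonal, triangle — the
  `hd_symm ∕ hd_zero ∕ hd_tri` of `inverse_decay` ∕ `resolvent_decay_uniform`; fibres of any size, indices sharing a site are at distance `0`).
* §2 THE SUMMABLE WEIGHT BY VALUE: **`rowSum_exp_neg_locDist_le`** (`Σ_j e^{−δ₀·d(i,j)} ≤ m₀(1 + 2∕δ₀)^d` — CKF's `hsum` with `K₀` NAMED;
  the generic-`m` twin of `B13Eq216LatticeSum.sum_exp_neg_l1dist_loc_le` in CKF's `−δ₀·d i j` currency), `colSum_exp_neg_locDist_le`, `one_le_of_fib`.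
* §3 THE COMBES–THOMAS SCHUR LETTER BY VALUE: **`weightedRowSum_le_of_decay`** ∕ **`weightedColSum_le_of_decay`** (`|T i j| ≤ c₀e^{−δ₁d(i,j)}`,
  `c₀ ≥ 0`, `δ₁ > 0`, `0 ≤ κ ≤ δ₁∕4` ⊢ `Σ_j |T i j|(e^{κd(i,j)} − 1) ≤ κ · c₀(4∕δ₁)·m₀(1 + 4∕δ₁)^d`, LINEAR in `κ` — verbatim `hrow ∕ hcol`).
* §4 THE END BY NAME: **`resolvent_decay_of_entrywise_decay`** (`T` `γ`-coercive (`γ > 0`) with the entrywise decay, ANY `κ` with `0 ≤ κ ≤ δ₁∕4`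
  and `κ·R ≤ γ∕2`, `R := c₀(4∕δ₁)m₀(1 + 4∕δ₁)^d` ⊢ `|(T + x·1)⁻¹(i,j)| ≤ 2γ⁻¹·e^{−κ d(i,j)}` for EVERY `x ≥ 0` — `resolvent_decay_uniform` with
  `ρ := γ∕2` and §1 ∕ §3 supplied), **`resolvent_decay_of_entrywise_decay_explicit`** (`c₀ > 0` ⊢ the rate `κ⋆ := min(δ₁∕4, γ∕(2R)) > 0` does it),
  **`inverse_decay_of_entrywise_decay`** (the `x = 0` member: `|T⁻¹(i,j)| ≤ 2γ⁻¹e^{−κd(i,j)}` — CKF §2–§3's `hdecay` for `A⁻¹ := T⁻¹` read off `T`'s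
  own two letters).
* §6 THE JUNCTION WITH THE GENERALISED SECT. 5 THEOREM BY NAME: `isPseudoDist_locDist` (`B4Sect5Torus.IsPseudoDist`), **`sumBound_locDist`**
  (`B4Sect5Torus.SumBound (|loc · − loc ·|₁) (fun a ↦ m₀(1 + 2∕a)^d)` — the index-set hypothesis of `sect5_uniform` for EVERY located index),
  **`inverse_decay_of_hyp56_loc`** ((5.7) for located indices: `Hyp56` ⊢ `|A⁻¹(i,j)| ≤ cSt·e^{−dSt·|loc i − loc j|₁}` with pv09's constants at this
  profile — `sect5_uniform` at the identity compression; (5.8) ∕ (5.10) apply verbatim through the same two lemmas).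
* §7 (v2.1, appended) THE SUP LETTER: **`abs_mulVec_le_of_decay`** — `|H i j| ≤ c₀e^{−δ₀|loc i − loc′ j|₁}` into a located set with fibres `≤ m₀`,
  `|J| ≤ J₀` ⊢ `|(H J)(i)| ≤ c₀·m₀(1 + 2∕δ₀)^d·J₀` = the (hJ) slot's `σ` letter in shape (`hj` of CFED `hJ_of_letters` ∕ LQL `hJ_of_local_quadratic`).
* §5 toys (kernel): two indices on `ℤ¹` (fibres `≤ 1`, §2 gives `≤ 3`); the identity matrix on any located index (`γ = c₀ = 1`, §4 applies).

NOT HERE (honest): the letters `γ` (E1: `…AdmissibleFloorIMS` ∕ `…CurlFormEnergyDomination` skeletons, inputs displayed) and `(c₀, δ₁)` (the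
(3.132)-type decay of `Δ_k = (QG₁Q*)⁻¹ − a − 𝒥` and the range of `C`: r1-g3 `QGQ-inverse-proof.md` T1′, written, not kernel-checked) BY VALUE
for print's `T = C*Δ_kC`; WHICH `loc` (bonds of `Λ̃` by lower endpoint; (A3) ∕ (A1c), NC-NE7b-α UNRULED); torus distances (the `T⁴` unit
lattice at step `k` is periodic — `B4Sect5Torus` is the periodic currency; a periodic `loc` is the consumer's); the random-walk half of
«`G̃₃(x)` has the same properties as `G̃₂`» (G-IF-10); constants not optimised.  BY-NAME EFFECT ON THE WALL: NONE (two displayed letters of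
displayed letters are now numbers; the wall is (R2)).  NE7b NOT PRINTED ∕ NOT PROVED; spine PROVED 0∕9; rung (B)+1 on a FINITE torus — NOT
infinite volume, NOT the mass gap, NOT Clay.  HONEST DEPENDENCY: continuum YM on T⁴ ⇐ BetaPertH ∧ nine spine estimates (0∕9 proved);
BetaPertH ⇐ (D1) ∧ (D4) ∧ CAP+tail; G-an2-4 gates asym, D1 and NE2∕3∕4.
-/

set_option autoImplicit false

noncomputable section

open Real Finset Matrix

namespace Summit.QuantumFields.BalabanUV.T4Continuum.NE7b.LocatedIndexDecayLetters

open Literature.MathematicalPhysics.QuantumFieldTheory.Balaban1983to89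
open Literature.MathematicalPhysics.QuantumFieldTheory.Balaban1983to89.B2Lemma25Proof (l1dist l1dist_nonneg l1dist_comm
  sum_exp_neg_l1dist_le)
open Literature.MathematicalPhysics.QuantumFieldTheory.Balaban1983to89.B4Sect5Proof (exp_weight_le)
open Literature.MathematicalPhysics.QuantumFieldTheory.Balaban1983to89.B9SectEKernel (resolvent_decay_uniform)

variable {d : ℕ} {m : Type*} [Fintype m]

/-! ## §1 The located pseudo-metric `d(i, j) = |loc i − loc j|₁`: the three letters of the finite Combes–Thomas bound -/

/-- `|x − x|₁ = 0`. [folklore] -/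
theorem l1dist_self (x : Fin d → ℤ) : l1dist x x = 0 := by
  unfold l1dist
  exact sum_eq_zero fun i _ => by rw [sub_self, Int.cast_zero, abs_zero]

/-- `|x − z|₁ ≤ |x − y|₁ + |y − z|₁`. [folklore] -/
theorem l1dist_triangle (x y z : Fin d → ℤ) : l1dist x z ≤ l1dist x y + l1dist y z := by
  unfold l1dist
  rw [← sum_add_distrib]
  refine sum_le_sum fun i _ => ?_
  have e : ((x i - z i : ℤ) : ℝ) = ((x i - y i : ℤ) : ℝ) + ((y i - z i : ℤ) : ℝ) := by push_cast; ring
  rw [e]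
  exact abs_add_le _ _

omit [Fintype m] in
/-- **THE PSEUDO-METRIC LETTERS OF A LOCATED INDEX**: for ANY `loc : m → ℤ^d` (fibres of any size — indices sharing a site are at
distance `0`), `d(i, j) := |loc i − loc j|₁` is symmetric, vanishes on the diagonal and satisfies the triangle inequality — verbatim the
`hd_symm ∕ hd_zero ∕ hd_tri` hypotheses of `QGQInverse.inverse_decay` ∕ `B9SectEKernel.resolvent_decay_uniform`. [folklore] -/
theorem locDist_letters (loc : m → (Fin d → ℤ)) :
    (∀ i j, l1dist (loc i) (loc j) = l1dist (loc j) (loc i)) ∧ (∀ i, l1dist (loc i) (loc i) = 0) ∧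
      ∀ i j k, l1dist (loc i) (loc k) ≤ l1dist (loc i) (loc j) + l1dist (loc j) (loc k) :=
  ⟨fun _ _ => l1dist_comm _ _, fun _ => l1dist_self _, fun _ _ _ => l1dist_triangle _ _ _⟩

/-! ## §2 The row-sum constant by value: `Σ_j e^{−δ₀|loc i − loc j|₁} ≤ m₀(1 + 2∕δ₀)^d` (the `hsum` letter of `…CovarianceKernelFloor`) -/

/-- **THE SUMMABLE-WEIGHT LETTER `K₀` BY VALUE**: if `loc : m → ℤ^d` places at most `m₀` indices at each site, then for every `i` and
`δ₀ > 0`, `Σ_j e^{−δ₀|loc i − loc j|₁} ≤ m₀·(1 + 2∕δ₀)^d` — group the sum by sites and apply the Literature's box-product bound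
`B2Lemma25Proof.sum_exp_neg_l1dist_le` to the occupied sites (the generic-`m` twin, in `…CovarianceKernelFloor`'s `−δ₀·d i j` currency, of
`B13Eq216LatticeSum.sum_exp_neg_l1dist_loc_le`).  This is `…CovarianceKernelFloor`'s displayed `hsum : Σ_j exp(−δ₀·d i j) ≤ K₀` with
`K₀ := m₀(1 + 2∕δ₀)^d` NAMED (its NOT-HERE: «the lattice value of `K₀(δ₀, d)`»). [folklore] -/
theorem rowSum_exp_neg_locDist_le {δ₀ : ℝ} (hδ : 0 < δ₀) (loc : m → (Fin d → ℤ)) {m₀ : ℕ}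
    (hfib : ∀ z : Fin d → ℤ, (univ.filter fun j => loc j = z).card ≤ m₀) (i : m) :
    ∑ j, exp (-δ₀ * l1dist (loc i) (loc j)) ≤ m₀ * (1 + 2 / δ₀) ^ d := by
  classical
  have hfw := sum_fiberwise_of_maps_to (s := (univ : Finset m)) (t := univ.image loc) (g := loc)
    (fun j hj => mem_image_of_mem loc hj) (fun j => exp (-δ₀ * l1dist (loc i) (loc j)))
  rw [← hfw]
  calc ∑ z ∈ univ.image loc, ∑ j ∈ univ.filter (fun j => loc j = z), exp (-δ₀ * l1dist (loc i) (loc j))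
      = ∑ z ∈ univ.image loc, ((univ.filter fun j => loc j = z).card : ℝ) * exp (-(δ₀ * l1dist (loc i) z)) := by
        refine sum_congr rfl fun z _ => ?_
        have hc : ∀ j ∈ univ.filter (fun j => loc j = z),
            exp (-δ₀ * l1dist (loc i) (loc j)) = exp (-(δ₀ * l1dist (loc i) z)) := fun j hj => by
          rw [(mem_filter.1 hj).2, neg_mul]
        rw [sum_congr rfl hc, sum_const, nsmul_eq_mul]
    _ ≤ ∑ z ∈ univ.image loc, (m₀ : ℝ) * exp (-(δ₀ * l1dist (loc i) z)) :=
        sum_le_sum fun z _ => mul_le_mul_of_nonneg_right (by exact_mod_cast hfib z) (exp_pos _).le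
    _ = m₀ * ∑ z ∈ univ.image loc, exp (-(δ₀ * l1dist (loc i) z)) := by rw [mul_sum]
    _ ≤ m₀ * (1 + 2 / δ₀) ^ d := mul_le_mul_of_nonneg_left (sum_exp_neg_l1dist_le hδ (loc i) _) (Nat.cast_nonneg m₀)

/-- The column form (symmetry of `|·|₁`): `Σ_i e^{−δ₀|loc i − loc j|₁} ≤ m₀·(1 + 2∕δ₀)^d`. [folklore] -/
theorem colSum_exp_neg_locDist_le {δ₀ : ℝ} (hδ : 0 < δ₀) (loc : m → (Fin d → ℤ)) {m₀ : ℕ}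
    (hfib : ∀ z : Fin d → ℤ, (univ.filter fun j => loc j = z).card ≤ m₀) (j : m) :
    ∑ i, exp (-δ₀ * l1dist (loc i) (loc j)) ≤ m₀ * (1 + 2 / δ₀) ^ d := by
  calc ∑ i, exp (-δ₀ * l1dist (loc i) (loc j)) = ∑ i, exp (-δ₀ * l1dist (loc j) (loc i)) :=
        sum_congr rfl fun i _ => by rw [l1dist_comm]
    _ ≤ m₀ * (1 + 2 / δ₀) ^ d := rowSum_exp_neg_locDist_le hδ loc hfib j

/-- Every fibre bound is at least `1` once the index set is inhabited (the fibre of `loc i` contains `i`). -/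
theorem one_le_of_fib (loc : m → (Fin d → ℤ)) {m₀ : ℕ}
    (hfib : ∀ z : Fin d → ℤ, (univ.filter fun j => loc j = z).card ≤ m₀) (i : m) : 1 ≤ m₀ := by
  classical
  have h : i ∈ univ.filter fun j => loc j = loc i := mem_filter.2 ⟨mem_univ _, rfl⟩
  exact (Nat.one_le_iff_ne_zero.2 (card_ne_zero.2 ⟨i, h⟩)).trans (hfib (loc i))

/-! ## §3 The Combes–Thomas Schur letter BY VALUE: entrywise decay ⟹ `Σ_j |T i j|·(e^{κ d(i,j)} − 1) ≤ κ·R` for `0 ≤ κ ≤ δ₁∕4` -/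

section Schur

variable {T : Matrix m m ℝ} {c₀ δ₁ κ : ℝ} {m₀ : ℕ}

/-- **THE WEIGHTED ROW SUMS BY VALUE**: `|T i j| ≤ c₀e^{−δ₁|loc i − loc j|₁}` (`c₀ ≥ 0`, `δ₁ > 0`), fibres `≤ m₀`, `0 ≤ κ ≤ δ₁∕4` ⟹
`Σ_j |T i j|·(e^{κ|loc i − loc j|₁} − 1) ≤ κ · c₀(4∕δ₁)·m₀(1 + 4∕δ₁)^d` — LINEAR in `κ` (termwise `e^{−δ₁n}(e^{κn} − 1) ≤ κ(4∕δ₁)e^{−δ₁n∕2}`,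
the Literature's `B4Sect5Proof.exp_weight_le` BY NAME, then §2 at rate `δ₁∕2`): verbatim the `hrow` hypothesis of `QGQInverse.inverse_decay` ∕
`B9SectEKernel.resolvent_decay_uniform` with `ρ := κ·R`. [folklore] -/
theorem weightedRowSum_le_of_decay (hc₀ : 0 ≤ c₀) (hδ₁ : 0 < δ₁) (hκ0 : 0 ≤ κ) (hκ : κ ≤ δ₁ / 4) (loc : m → (Fin d → ℤ))
    (hfib : ∀ z : Fin d → ℤ, (univ.filter fun j => loc j = z).card ≤ m₀)
    (hT : ∀ i j, |T i j| ≤ c₀ * exp (-(δ₁ * l1dist (loc i) (loc j)))) (i : m) :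
    ∑ j, |T i j| * (exp (κ * l1dist (loc i) (loc j)) - 1) ≤ κ * (c₀ * (4 / δ₁) * (m₀ * (1 + 4 / δ₁) ^ d)) := by
  have hterm : ∀ j, |T i j| * (exp (κ * l1dist (loc i) (loc j)) - 1) ≤
      c₀ * (κ * (4 / δ₁)) * exp (-(δ₁ / 2) * l1dist (loc i) (loc j)) := by
    intro j
    set n : ℝ := l1dist (loc i) (loc j) with hn
    have hn0 : 0 ≤ n := l1dist_nonneg _ _
    have hw0 : 0 ≤ exp (κ * n) - 1 := by linarith [one_le_exp (mul_nonneg hκ0 hn0)]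
    have hw := exp_weight_le (n := n) hδ₁ hκ0 hκ hn0
    calc |T i j| * (exp (κ * n) - 1) ≤ c₀ * exp (-(δ₁ * n)) * (exp (κ * n) - 1) :=
        mul_le_mul_of_nonneg_right (hT i j) hw0
      _ = c₀ * (exp (-(δ₁ * n)) * (exp (κ * n) - 1)) := by ring
      _ ≤ c₀ * (κ * (4 / δ₁) * exp (-(δ₁ / 2 * n))) := mul_le_mul_of_nonneg_left hw hc₀
      _ = c₀ * (κ * (4 / δ₁)) * exp (-(δ₁ / 2) * n) := by rw [neg_mul]; ring
  have h4 : (1 : ℝ) + 2 / (δ₁ / 2) = 1 + 4 / δ₁ := by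
    have hδ0 : δ₁ ≠ 0 := hδ₁.ne'
    field_simp
    ring
  calc ∑ j, |T i j| * (exp (κ * l1dist (loc i) (loc j)) - 1)
      ≤ ∑ j, c₀ * (κ * (4 / δ₁)) * exp (-(δ₁ / 2) * l1dist (loc i) (loc j)) := sum_le_sum fun j _ => hterm j
    _ = c₀ * (κ * (4 / δ₁)) * ∑ j, exp (-(δ₁ / 2) * l1dist (loc i) (loc j)) := by rw [mul_sum]
    _ ≤ c₀ * (κ * (4 / δ₁)) * (m₀ * (1 + 2 / (δ₁ / 2)) ^ d) :=
        mul_le_mul_of_nonneg_left (rowSum_exp_neg_locDist_le (half_pos hδ₁) loc hfib i) (by positivity)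
    _ = κ * (c₀ * (4 / δ₁) * (m₀ * (1 + 4 / δ₁) ^ d)) := by rw [h4]; ring

/-- The column twin (`hcol`): `Σ_i |T i j|·(e^{κ|loc i − loc j|₁} − 1) ≤ κ · c₀(4∕δ₁)·m₀(1 + 4∕δ₁)^d`. [folklore] -/
theorem weightedColSum_le_of_decay (hc₀ : 0 ≤ c₀) (hδ₁ : 0 < δ₁) (hκ0 : 0 ≤ κ) (hκ : κ ≤ δ₁ / 4) (loc : m → (Fin d → ℤ))
    (hfib : ∀ z : Fin d → ℤ, (univ.filter fun j => loc j = z).card ≤ m₀)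
    (hT : ∀ i j, |T i j| ≤ c₀ * exp (-(δ₁ * l1dist (loc i) (loc j)))) (j : m) :
    ∑ i, |T i j| * (exp (κ * l1dist (loc i) (loc j)) - 1) ≤ κ * (c₀ * (4 / δ₁) * (m₀ * (1 + 4 / δ₁) ^ d)) := by
  have hT' : ∀ i j, |Tᵀ i j| ≤ c₀ * exp (-(δ₁ * l1dist (loc i) (loc j))) := fun i j => by
    rw [transpose_apply, l1dist_comm]; exact hT j i
  calc ∑ i, |T i j| * (exp (κ * l1dist (loc i) (loc j)) - 1)
      = ∑ i, |Tᵀ j i| * (exp (κ * l1dist (loc j) (loc i)) - 1) :=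
        sum_congr rfl fun i _ => by rw [transpose_apply, l1dist_comm]
    _ ≤ κ * (c₀ * (4 / δ₁) * (m₀ * (1 + 4 / δ₁) ^ d)) := weightedRowSum_le_of_decay hc₀ hδ₁ hκ0 hκ loc hfib hT' j

end Schur

/-! ## §4 The END BY NAME: the resolvent family of a coercive, entrywise-decaying `T` decays, UNIFORMLY in `x ≥ 0` (Theorem E3 with (b) discharged) -/

section Resolvent

variable [DecidableEq m] {T : Matrix m m ℝ} {γ c₀ δ₁ : ℝ} {m₀ : ℕ}

/-- **THE RESOLVENT DECAY FROM TWO LETTERS OF `T` ITSELF** — coercivity `γ > 0` and the entrywise decay `|T i j| ≤ c₀e^{−δ₁|loc i − loc j|₁}`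
on an index located on `ℤ^d` with fibres `≤ m₀`: for every rate `κ` with `0 ≤ κ ≤ δ₁∕4` and `κ·c₀(4∕δ₁)m₀(1 + 4∕δ₁)^d ≤ γ∕2`, EVERY member
of the resolvent family obeys `|(T + x·1)⁻¹(i, j)| ≤ 2γ⁻¹·e^{−κ|loc i − loc j|₁}` (`x ≥ 0`) — `B9SectEKernel.resolvent_decay_uniform` BY NAME with
its pseudo-metric letters (§1) and its Schur letters `hrow ∕ hcol` (§3, `ρ := γ∕2`) SUPPLIED; the written repair's Theorem E3
(`SectE-interface-proof.md` §7) with input (b) — listed there §8.5 among the NOT kernel-checked — DISCHARGED in the located-index currency. [folklore] -/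
theorem resolvent_decay_of_entrywise_decay (hγ : 0 < γ) (hc₀ : 0 ≤ c₀) (hδ₁ : 0 < δ₁) (hT : QGQInverse.Coercive T γ)
    (loc : m → (Fin d → ℤ)) (hfib : ∀ z : Fin d → ℤ, (univ.filter fun j => loc j = z).card ≤ m₀)
    (hdec : ∀ i j, |T i j| ≤ c₀ * exp (-(δ₁ * l1dist (loc i) (loc j)))) {κ : ℝ} (hκ0 : 0 ≤ κ) (hκ1 : κ ≤ δ₁ / 4)
    (hκ2 : κ * (c₀ * (4 / δ₁) * (m₀ * (1 + 4 / δ₁) ^ d)) ≤ γ / 2) {x : ℝ} (hx : 0 ≤ x) (i j : m) :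
    |(T + x • (1 : Matrix m m ℝ))⁻¹ i j| ≤ 2 * γ⁻¹ * exp (-(κ * l1dist (loc i) (loc j))) := by
  obtain ⟨hs, hz, ht⟩ := locDist_letters loc
  have h := resolvent_decay_uniform T (fun i j => l1dist (loc i) (loc j)) (ρ := γ / 2) (by linarith) hκ0 hT hs hz ht
    (fun i => (weightedRowSum_le_of_decay hc₀ hδ₁ hκ0 hκ1 loc hfib hdec i).trans hκ2)
    (fun j => (weightedColSum_le_of_decay hc₀ hδ₁ hκ0 hκ1 loc hfib hdec j).trans hκ2) hx i j
  have e : (γ - γ / 2)⁻¹ = 2 * γ⁻¹ := by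
    rw [show γ - γ / 2 = γ / 2 by ring, inv_div, div_eq_mul_inv]
  rw [e] at h
  exact h

/-- **… WITH THE RATE NAMED**: `κ⋆ := min(δ₁∕4, γ∕(2R))`, `R := c₀(4∕δ₁)m₀(1 + 4∕δ₁)^d` (`c₀ > 0`, index inhabited) satisfies the three
rate conditions, so `|(T + x·1)⁻¹(i, j)| ≤ 2γ⁻¹·e^{−κ⋆|loc i − loc j|₁}` for all `x ≥ 0` with `κ⋆ > 0` EXPLICIT in `(γ, c₀, δ₁, m₀, d)` —
constants independent of `x` (and of whatever `k, Λ, U` the letters `γ, c₀, δ₁` are uniform in). [folklore] -/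
theorem resolvent_decay_of_entrywise_decay_explicit (hγ : 0 < γ) (hc₀ : 0 < c₀) (hδ₁ : 0 < δ₁) (hT : QGQInverse.Coercive T γ)
    (loc : m → (Fin d → ℤ)) (hfib : ∀ z : Fin d → ℤ, (univ.filter fun j => loc j = z).card ≤ m₀)
    (hdec : ∀ i j, |T i j| ≤ c₀ * exp (-(δ₁ * l1dist (loc i) (loc j)))) {x : ℝ} (hx : 0 ≤ x) (i j : m) :
    0 < min (δ₁ / 4) (γ / (2 * (c₀ * (4 / δ₁) * (m₀ * (1 + 4 / δ₁) ^ d)))) ∧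
      |(T + x • (1 : Matrix m m ℝ))⁻¹ i j|
        ≤ 2 * γ⁻¹ * exp (-(min (δ₁ / 4) (γ / (2 * (c₀ * (4 / δ₁) * (m₀ * (1 + 4 / δ₁) ^ d)))) * l1dist (loc i) (loc j))) := by
  set R : ℝ := c₀ * (4 / δ₁) * (m₀ * (1 + 4 / δ₁) ^ d) with hR
  have hm₀ : (1 : ℝ) ≤ m₀ := by exact_mod_cast one_le_of_fib loc hfib i
  have hRpos : 0 < R := by positivity
  have hκ0 : 0 ≤ min (δ₁ / 4) (γ / (2 * R)) := le_min (by positivity) (by positivity)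
  refine ⟨lt_min (by positivity) (by positivity), ?_⟩
  refine resolvent_decay_of_entrywise_decay hγ hc₀.le hδ₁ hT loc hfib hdec hκ0 (min_le_left _ _) ?_ hx i j
  calc min (δ₁ / 4) (γ / (2 * R)) * R ≤ γ / (2 * R) * R := mul_le_mul_of_nonneg_right (min_le_right _ _) hRpos.le
    _ = γ / 2 := by field_simp

/-- **THE `x = 0` MEMBER** (the inverse itself, `QGQInverse.inverse_decay`'s conclusion with its Schur letters valued): under the same two
letters, `|T⁻¹(i, j)| ≤ 2γ⁻¹·e^{−κ|loc i − loc j|₁}` — the decay letter `hdecay` of `…CovarianceKernelFloor` §2–§3 for `A⁻¹ := T⁻¹`, read off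
`T`'s OWN decay and floor. [folklore] -/
theorem inverse_decay_of_entrywise_decay (hγ : 0 < γ) (hc₀ : 0 ≤ c₀) (hδ₁ : 0 < δ₁) (hT : QGQInverse.Coercive T γ)
    (loc : m → (Fin d → ℤ)) (hfib : ∀ z : Fin d → ℤ, (univ.filter fun j => loc j = z).card ≤ m₀)
    (hdec : ∀ i j, |T i j| ≤ c₀ * exp (-(δ₁ * l1dist (loc i) (loc j)))) {κ : ℝ} (hκ0 : 0 ≤ κ) (hκ1 : κ ≤ δ₁ / 4)
    (hκ2 : κ * (c₀ * (4 / δ₁) * (m₀ * (1 + 4 / δ₁) ^ d)) ≤ γ / 2) (i j : m) :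
    |T⁻¹ i j| ≤ 2 * γ⁻¹ * exp (-(κ * l1dist (loc i) (loc j))) := by
  have h := resolvent_decay_of_entrywise_decay hγ hc₀ hδ₁ hT loc hfib hdec hκ0 hκ1 hκ2 le_rfl i j
  rwa [zero_smul, add_zero] at h

end Resolvent

/-! ## §6 The junction with the tree's GENERALISED Sect. 5 theorem ([B4] p. 594 over any finite index set with a pseudo-distance and a
lattice-sum profile — `B4Sect5Torus.sect5_uniform`, pv09): located indices ARE an instance, with profile `K(a) := m₀(1 + 2∕a)^d` -/

section Sect5

open Literature.MathematicalPhysics.QuantumFieldTheory.Balaban1983to89.B4Sect5Torus (IsPseudoDist SumBound Hyp56 sect5_uniform cSt dSt)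

omit [Fintype m] in
/-- **`|loc · − loc ·|₁` IS A PSEUDO-DISTANCE** in `B4Sect5Torus`'s sense (§1 repackaged as the structure `IsPseudoDist`). [folklore] -/
theorem isPseudoDist_locDist (loc : m → (Fin d → ℤ)) : IsPseudoDist (fun i j : m => l1dist (loc i) (loc j)) :=
  ⟨fun _ _ => l1dist_comm _ _, fun _ => l1dist_self _, fun _ _ _ => l1dist_triangle _ _ _⟩

/-- **LOCATED INDICES OBEY THE LATTICE-SUM PROFILE `K(a) = m₀(1 + 2∕a)^d`** — `B4Sect5Torus.SumBound` (the one hypothesis of the generalised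
Sect. 5 theorem that is about the index set) discharged by §2 for every `loc` with fibres `≤ m₀`. [folklore] -/
theorem sumBound_locDist (loc : m → (Fin d → ℤ)) {m₀ : ℕ} (hfib : ∀ z : Fin d → ℤ, (univ.filter fun j => loc j = z).card ≤ m₀) :
    SumBound (fun i j : m => l1dist (loc i) (loc j)) (fun a : ℝ => m₀ * (1 + 2 / a) ^ d) := by
  intro a ha i
  have h := rowSum_exp_neg_locDist_le ha loc hfib i
  simpa only [neg_mul] using h

variable [DecidableEq m]

/-- **THE GENERALISED SECT. 5 THEOREM FOR LOCATED INDICES, BY NAME**: for `A` with (5.6) in the located distance (`Hyp56`: symmetric,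
`γ₀`-coercive as a real form, `|A i j| ≤ c₀e^{−δ₀|loc i − loc j|₁}`), the inverse decays — `|A⁻¹(i,j)| ≤ c₁⋆·e^{−δ₁⋆|loc i − loc j|₁}` with
`(c₁⋆, δ₁⋆) = (cSt, dSt)` of `B4Sect5Torus` at the profile `m₀(1 + 2∕·)^d`, chosen BEFORE the instance (so uniform in the index set, in `loc`,
and in whatever `γ₀, c₀, δ₀` are uniform in) — `B4Sect5Torus.sect5_uniform` (5.7) at the identity compression, its `IsPseudoDist` ∕ `SumBound`
hypotheses supplied by `isPseudoDist_locDist` ∕ `sumBound_locDist`.  (The compressions (5.8) and perturbations (5.10) of the same theorem apply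
verbatim to located indices through the same two lemmas; only (5.7) is restated here.) [folklore] -/
theorem inverse_decay_of_hyp56_loc {γ₀ c₀ δ₀ : ℝ} (hγ : 0 < γ₀) (hc : 0 < c₀) (hδ : 0 < δ₀) (loc : m → (Fin d → ℤ)) {m₀ : ℕ}
    (hfib : ∀ z : Fin d → ℤ, (univ.filter fun j => loc j = z).card ≤ m₀) {A : Matrix m m ℝ}
    (hA : Hyp56 (fun i j : m => l1dist (loc i) (loc j)) A γ₀ c₀ δ₀) (i j : m) :
    |A⁻¹ i j| ≤ cSt (fun a : ℝ => m₀ * (1 + 2 / a) ^ d) γ₀ c₀ δ₀ *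
      exp (-(dSt (fun a : ℝ => m₀ * (1 + 2 / a) ^ d) γ₀ c₀ δ₀ * l1dist (loc i) (loc j))) := by
  have hK : ∀ a : ℝ, 0 < a → 0 ≤ (m₀ : ℝ) * (1 + 2 / a) ^ d := fun a ha => by positivity
  have h := (sect5_uniform hK hγ hc hδ (isPseudoDist_locDist loc) (sumBound_locDist loc hfib) hA
    (e := id) Function.injective_id).1 i j
  simpa only [Matrix.submatrix_id_id, id_eq] using h

end Sect5

/-! ## §7 (v2.1, appended) The SUP letter of a decaying kernel: `|(H J)(i)| ≤ c₀·m₀(1 + 2∕δ₀)^d·sup|J|` — the `σ` letter of the (hJ) slot -/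

section SupLetter

variable {p : Type*} [Fintype p]

omit [Fintype m] in
/-- **A DECAYING KERNEL APPLIED TO A BOUNDED FIELD IS BOUNDED BY THE ROW-SUM CONSTANT**: `|H i j| ≤ c₀e^{−δ₀|loc i − loc′ j|₁}` between two
located index sets (`loc : m → ℤ^d`, `loc′ : p → ℤ^d`, the second with fibres `≤ m₀`), `c₀ ≥ 0`, `δ₀ > 0`, and `|J j| ≤ J₀` (`J₀ ≥ 0`) ⊢
`|(H *ᵥ J) i| ≤ c₀·m₀(1 + 2∕δ₀)^d·J₀` — §2's row-sum constant times the two sizes.  This is the SHAPE of the (hJ) slot's first letter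
`σ = sup|H₁*J| ≤ c_H·Mα₀` (`SectE-interface-proof.md` Lemma 5.7, (π6): the (3.133)-decay of `H₁` against a field `J` of size `Mα₀`), i.e. the `hj : |j x| ≤ σ`
hypothesis of `…CurlFormEnergyDomination.hJ_of_letters` ∕ `…LocalQuadraticL1Letter.hJ_of_local_quadratic` with `σ := c₀·m₀(1 + 2∕δ₀)^d·J₀`. [folklore] -/
theorem abs_mulVec_le_of_decay (loc : m → (Fin d → ℤ)) (loc' : p → (Fin d → ℤ)) {m₀ : ℕ}
    (hfib : ∀ z : Fin d → ℤ, (univ.filter fun j => loc' j = z).card ≤ m₀) (H : Matrix m p ℝ) {c₀ δ₀ : ℝ} (hc₀ : 0 ≤ c₀) (hδ : 0 < δ₀)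
    (hH : ∀ i j, |H i j| ≤ c₀ * exp (-(δ₀ * l1dist (loc i) (loc' j)))) (J : p → ℝ) {J₀ : ℝ} (hJ₀ : 0 ≤ J₀) (hJ : ∀ j, |J j| ≤ J₀)
    (i : m) : |(H *ᵥ J) i| ≤ c₀ * (m₀ * (1 + 2 / δ₀) ^ d) * J₀ := by
  classical
  -- the row sum of the decaying kernel from `loc i` into the located set `loc'`
  have hrow : ∑ j, exp (-(δ₀ * l1dist (loc i) (loc' j))) ≤ m₀ * (1 + 2 / δ₀) ^ d := by
    have hfw := sum_fiberwise_of_maps_to (s := (univ : Finset p)) (t := univ.image loc') (g := loc')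
      (fun j hj => mem_image_of_mem loc' hj) (fun j => exp (-(δ₀ * l1dist (loc i) (loc' j))))
    rw [← hfw]
    calc ∑ z ∈ univ.image loc', ∑ j ∈ univ.filter (fun j => loc' j = z), exp (-(δ₀ * l1dist (loc i) (loc' j)))
        = ∑ z ∈ univ.image loc', ((univ.filter fun j => loc' j = z).card : ℝ) * exp (-(δ₀ * l1dist (loc i) z)) := by
          refine sum_congr rfl fun z _ => ?_
          rw [sum_congr rfl fun j hj => by rw [(mem_filter.1 hj).2], sum_const, nsmul_eq_mul]
      _ ≤ ∑ z ∈ univ.image loc', (m₀ : ℝ) * exp (-(δ₀ * l1dist (loc i) z)) :=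
          sum_le_sum fun z _ => mul_le_mul_of_nonneg_right (by exact_mod_cast hfib z) (exp_pos _).le
      _ = m₀ * ∑ z ∈ univ.image loc', exp (-(δ₀ * l1dist (loc i) z)) := by rw [mul_sum]
      _ ≤ m₀ * (1 + 2 / δ₀) ^ d := mul_le_mul_of_nonneg_left (sum_exp_neg_l1dist_le hδ (loc i) _) (Nat.cast_nonneg m₀)
  calc |(H *ᵥ J) i| = |∑ j, H i j * J j| := rfl
    _ ≤ ∑ j, |H i j * J j| := abs_sum_le_sum_abs _ _
    _ ≤ ∑ j, c₀ * exp (-(δ₀ * l1dist (loc i) (loc' j))) * J₀ := sum_le_sum fun j _ => by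
        rw [abs_mul]; exact mul_le_mul (hH i j) (hJ j) (abs_nonneg _) (by positivity)
    _ = c₀ * (∑ j, exp (-(δ₀ * l1dist (loc i) (loc' j)))) * J₀ := by rw [mul_sum, sum_mul]
    _ ≤ c₀ * (m₀ * (1 + 2 / δ₀) ^ d) * J₀ :=
        mul_le_mul_of_nonneg_right (mul_le_mul_of_nonneg_left hrow hc₀) hJ₀

end SupLetter

/-! ## §5 Toys (kernel): the letters are inhabited -/

/-- Toy: two indices located at the sites `0` and `1` of `ℤ¹` (`loc i := (i : ℤ)`); every fibre has at most one index, and §2 gives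
`Σ_j e^{−|loc i − loc j|₁} ≤ 1·(1 + 2)¹ = 3`. -/
example (i : Fin 2) :
    ∑ j : Fin 2, exp (-1 * l1dist (fun _ : Fin 1 => ((i : ℕ) : ℤ)) (fun _ : Fin 1 => ((j : ℕ) : ℤ))) ≤ (1 : ℕ) * (1 + 2 / 1) ^ 1 := by
  refine rowSum_exp_neg_locDist_le one_pos (fun i : Fin 2 => fun _ : Fin 1 => ((i : ℕ) : ℤ)) (fun z => ?_) i
  rw [Finset.card_le_one]
  intro a ha b hb
  have hab : ((a : ℕ) : ℤ) = ((b : ℕ) : ℤ) := by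
    have h := congrFun (((mem_filter.1 ha).2).trans ((mem_filter.1 hb).2).symm) 0
    simpa using h
  exact Fin.ext (by exact_mod_cast hab)

/-- Toy: the identity matrix on ANY located index is `1`-coercive and decays with `c₀ = 1` at any rate (`|1 i j| ≤ e^{−δ₁ d(i,j)}`: off the
diagonal the entry is `0`, on it the distance is `0`), so §4 applies: `|(1 + x·1)⁻¹ i j| ≤ 2e^{−κ d(i,j)}` for the admissible `κ`. -/
example [DecidableEq m] (loc : m → (Fin d → ℤ)) {m₀ : ℕ} (hfib : ∀ z : Fin d → ℤ, (univ.filter fun j => loc j = z).card ≤ m₀)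
    {κ : ℝ} (hκ0 : 0 ≤ κ) (hκ1 : κ ≤ 1 / 4) (hκ2 : κ * (1 * (4 / 1) * (m₀ * (1 + 4 / 1) ^ d)) ≤ 1 / 2) {x : ℝ} (hx : 0 ≤ x)
    (i j : m) : |((1 : Matrix m m ℝ) + x • (1 : Matrix m m ℝ))⁻¹ i j| ≤ 2 * (1 : ℝ)⁻¹ * exp (-(κ * l1dist (loc i) (loc j))) := by
  refine resolvent_decay_of_entrywise_decay one_pos zero_le_one one_pos (fun v => ?_) loc hfib (fun i j => ?_) hκ0 hκ1 hκ2 hx i j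
  · rw [one_mulVec, one_mul]
  · by_cases hij : i = j
    · subst hij
      rw [one_apply_eq, abs_one, l1dist_self, mul_zero, neg_zero, exp_zero, mul_one]
    · rw [one_apply_ne hij, abs_zero]
      positivity

end Summit.QuantumFields.BalabanUV.T4Continuum.NE7b.LocatedIndexDecayLetters

end
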